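import Summits.BirchSwinnertonDyer.BirchSwinnertonDyer.Theorems.AdditiveBranchIMCGenusKolyvaginLabelsTraceCongruence
import Summits.BirchSwinnertonDyer.BirchSwinnertonDyer.Theorems.AdditiveBranchIMCGenusKolyvaginLabelsConjugation
import Summits.BirchSwinnertonDyer.BirchSwinnertonDyer.Theorems.AdditiveBranchIMCGenusKolyvaginCarrierLabelsGuarded
import Summits.BirchSwinnertonDyer.BirchSwinnertonDyer.Theorems.ClassRecordThreeShimuraKolyvaginConjugationKLevelOfLabels
import Literature.NumberTheory.EllipticCurves.HeegnerPointsOfConductorRationalityBirch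
import Literature.NumberTheory.EllipticCurves.HeegnerPointsOfConductorConjugationBirch
import HarnessLib

/-!
# Crux `GordTwoRankZeroOffCaseOne` (+ twin `MultLower`): the registered stub `stub_genusKolyvaginPointsR[M]` UNBUNDLED —
# the genus Heegner system as RING-CLASS-RATIONAL KOLYVAGIN DATA for `Wd` over the `p`-ramified field `K″`

Cell `bsd-addord`, lead seat `cruxlead-19357` (g2); HELPER landed `--supports … --as helper`; the skeleton (v10) closes
`stub_genusKolyvaginPointsR[M]` by ONE application of `genusKolyvaginPointsR_of_facts` to the fields of its
`GenusHeegnerSetting` and three conjuncts of `PrintedFacts{R0,M}`. THEOREMS ONLY (no definition, no named fact, no `sorry`).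

## What

`genusKolyvaginPointsR_of_facts`: for the fourth curve `E′` (globally minimal) of the genus transport with datum `Dt`,
Birch orientation `β`, root `θ = √d₁ ∈ K″[1]` with its genus signs `s(σ)`, conductor-one point `y` and the transported genus
point `P ∈ Wd(K″)` (`P↑ = Θ_θ(Σ_σ s(σ)·σy)`), `Wd = C₂ • (D • E′)^{(d₁)}` globally minimal with `ρ̄_{Wd,p}` onto, `p ≥ 5`:
the conclusion of the line's `GenusKolyvaginPointsR Wd p K″ ι P` (VERBATIM the body of that skeleton def) holds, GIVEN
three printed facts BY NAME — (G1) `phi_heegnerPointOfConductor_mem_range_map_ringClassField_birch` (Darmon Thm 3.6 ∕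
Gross 1984 §I: CM rationality under Birch), (B5) `Nekovar2007.cmPoint_frobeniusCongruence` (Nekovář 2007 Prop. 4.9), (B3)
`GrossLMS1991.prop53_conj_pinned_birch` (Gross 1991 Prop. 5.3, pinned) — and `nonempty_modularParametrizationData`.
Proof = bsd-stepL's K4e in its Kolyvagin-guarded form (`hpointsRk_of_shimuraLabels_kolyvaginGuarded`, depth `k = 0`) fed
with the bare family `y″(m) = Θ_{ϑ_m}(y_{E′}(m))`, `ϑ_m = χ(m)·θ↑`, `χ(m) = (d₁/m)` on Kolyvagin levels, the sign
`ε = −w(E′)·sgn(d₁)·s(σ₁)` (`σ₁` the pin of Prop. 5.3), and the labels: (B2) from `P`'s defining identity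
(`twist_sum_smul_pointGalHom'`), (B3) `label_B3_level`, (B3₀) bsd-stepL's `isOfFinAddOrder_map_sub_smul_of_labels`,
(B4) `label_B4_level`, (B5) `label_B5_level`.

HONEST FRAMING: conditional on the three named facts (hypotheses here, conjuncts of the line's `PrintedFacts`); the
local clause (d) off `m` (`stub_genusKolyvaginLocal[M]`) is NOT touched. BSD is not proved by any of this.
[cite: GrossLMS1991, §§3–5 (Props. 3.7, 5.3, 5.4)] [cite: McCallumLMS1991, §4] [cite: Nekovar2007, Prop. 4.9]
[cite: Darmon2004, Thm. 3.6] [cite: SilvermanAEC2009, X.2 Prop. 2.4, X.5 Cor. 5.4]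
presearch: n/a (assembly of tree theorems + three named facts; lead reports 3–4 of the crux record the literature audit).
-/

noncomputable section

open scoped Classical ComplexConjugate

set_option linter.dupNamespace false
set_option autoImplicit false
set_option maxHeartbeats 800000

namespace Summit.BirchSwinnertonDyer.BirchSwinnertonDyer.Theorems.GenusKolyvagin

open WeierstrassCurve NumberField Field IsDedekindDomain Literature.NumberTheory.EllipticCurves
  Literature.NumberTheory.EllipticCurves.ModularForms
  Summit.BirchSwinnertonDyer.Rank1Residual.X11b

variable {K : Type} [Field K] [NumberField K]

/-- `Θ` depends on the root only through its value (congruence for the proof arguments). [folklore] -/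
theorem twist_congr (E' : WeierstrassCurve ℚ) (D C₂ : VariableChange ℚ) [(D • E').IsCharNeTwoNF] (d₁ : ℤ)
    {L : Type} [Field L] [Algebra ℚ L] [DecidableEq L] {ϑ ϑ' : L}
    (hϑ2 : ϑ ^ 2 = algebraMap ℚ L (d₁ : ℚ)) (hϑ0 : ϑ ≠ 0)
    (hϑ'2 : ϑ' ^ 2 = algebraMap ℚ L (d₁ : ℚ)) (hϑ'0 : ϑ' ≠ 0) (h : ϑ = ϑ')
    (Q : (E'.baseChange L).toAffine.Point) :
    (VariableChange.pointEquivBaseChange ((D • E').quadraticTwist (d₁ : ℚ)) C₂ L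
          ((VariableChange.pointEquiv (((D • E').quadraticTwist (d₁ : ℚ)).baseChange L) (untwistAt hϑ0)).symm
            ((Affine.Point.congrEquiv (untwistAt_smul_eq (D • E') hϑ2 hϑ0)).symm
              (VariableChange.pointEquivBaseChange E' D L Q)))) = (VariableChange.pointEquivBaseChange ((D • E').quadraticTwist (d₁ : ℚ)) C₂ L
          ((VariableChange.pointEquiv (((D • E').quadraticTwist (d₁ : ℚ)).baseChange L) (untwistAt hϑ'0)).symm
            ((Affine.Point.congrEquiv (untwistAt_smul_eq (D • E') hϑ'2 hϑ'0)).symm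
              (VariableChange.pointEquivBaseChange E' D L Q)))) := by
  subst h; rfl

/-- **THE STUB `stub_genusKolyvaginPointsR[M]` UNBUNDLED** — see the module docstring. [cite: GrossLMS1991, §§3–5]
[cite: McCallumLMS1991, §4] [cite: Nekovar2007, Prop. 4.9] [cite: Darmon2004, Thm. 3.6] -/
theorem genusKolyvaginPointsR_of_facts
    (hG1 : ∀ (N : ℕ) [NeZero N] (W : WeierstrassCurve ℚ) (K : Type) [Field K] [NumberField K],
      phi_heegnerPointOfConductor_mem_range_map_ringClassField_birch N W K)
    (hNek : Nekovar2007.cmPoint_frobeniusCongruence)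
    (hP53 : ∀ (N : ℕ) [NeZero N] (W : WeierstrassCurve ℚ) (K : Type) [Field K] [NumberField K],
      GrossLMS1991.prop53_conj_pinned_birch N W K)
    (hmodP : nonempty_modularParametrizationData)
    (hK : IsImaginaryQuadratic K) (hD4 : NumberField.discr K < -4) (ι : K →+* ℂ)
    (E' : WeierstrassCurve ℚ) [E'.IsElliptic] [E'.IsGloballyMinimal] [NeZero (E'.conductorNorm ℤ)]
    (D C₂ : VariableChange ℚ) [(D • E').IsCharNeTwoNF] (d₁ : ℤ)
    [(C₂ • (D • E').quadraticTwist (d₁ : ℚ)).IsElliptic] [(C₂ • (D • E').quadraticTwist (d₁ : ℚ)).IsGloballyMinimal]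
    (hE' : ∃ C : VariableChange ℚ, C • (C₂ • (D • E').quadraticTwist (d₁ : ℚ)).quadraticTwist (d₁ : ℚ) = E')
    (hd₁ : d₁ ∣ NumberField.discr K)
    (Dt : ModularParametrizationData E' (E'.conductorNorm ℤ)) {β : ℤ}
    (hβ : (4 * (E'.conductorNorm ℤ : ℤ)) ∣ β ^ 2 - NumberField.discr K)
    {θ : ringClassField K ι 1} (hθ2 : θ ^ 2 = algebraMap ℚ (ringClassField K ι 1) (d₁ : ℚ)) (hθ0 : θ ≠ 0)
    (s : ringClassGal ι 1 → ℤˣ)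
    (hθσ : ∀ σ : ringClassGal ι 1, σ.1 θ = ((s σ : ℤ) : ringClassField K ι 1) * θ)
    {y : (E'.baseChange (ringClassField K ι 1)).toAffine.Point}
    (hy : Affine.Point.map (ringClassField K ι 1).subtype.toRatAlgHom y =
      heegnerPointComplexOfConductor Dt (NumberField.discr K) β 1)
    {instF : Fintype (ringClassGal ι 1)}
    {P : ((C₂ • (D • E').quadraticTwist (d₁ : ℚ)).baseChange K).toAffine.Point}
    (hP : Affine.Point.map (algebraMap K (ringClassField K ι 1)).toRatAlgHom P =
      (VariableChange.pointEquivBaseChange ((D • E').quadraticTwist (d₁ : ℚ)) C₂ (ringClassField K ι 1)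
          ((VariableChange.pointEquiv (((D • E').quadraticTwist (d₁ : ℚ)).baseChange (ringClassField K ι 1)) (untwistAt hθ0)).symm
            ((Affine.Point.congrEquiv (untwistAt_smul_eq (D • E') hθ2 hθ0)).symm
              (VariableChange.pointEquivBaseChange E' D (ringClassField K ι 1) (∑ τ : ringClassGal ι 1, (s τ : ℤ) • pointGalHom E' (ringClassField K ι 1) τ.1 y))))))
    {p : ℕ} [Fact p.Prime] (hp5 : 5 ≤ p)
    (hsurj : (C₂ • (D • E').quadraticTwist (d₁ : ℚ)).HasSurjectiveModNGaloisRep p) :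
      ∀ {M : ℕ} (_hM : 1 ≤ M)
      (hdiv : ∀ Q : geomPoints ((C₂ • (D • E').quadraticTwist (d₁ : ℚ)).baseChange K), ∃ R, ((p ^ M : ℕ) : ℤ) • R = Q)
      (c : K ≃ₐ[ℚ] K) (_hc : c ≠ 1),
      ∃ (ε : ℤ) (τ : AlgebraicClosure K ≃+* AlgebraicClosure K) (hτ : IsLiftOfAut c τ)
        (A : ℕ → AddSubgroup (geomPoints ((C₂ • (D • E').quadraticTwist (d₁ : ℚ)).baseChange K)))
        (hA : ∀ m, KolyvaginCocycle.IsAdmissible (Field.absoluteGaloisGroup K) (A m)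
          ((p ^ M : ℕ) : ℤ))
        (emb : ∀ m : ℕ, ringClassField K ι m →ₐ[K] AlgebraicClosure K)
        (Pt : ℕ → geomPoints ((C₂ • (D • E').quadraticTwist (d₁ : ℚ)).baseChange K))
        (hPt : ∀ m, Pt m ∈
          KolyvaginCocycle.invPoints (Field.absoluteGaloisGroup K) (A m) ((p ^ M : ℕ) : ℤ)),
        (ε = 1 ∨ ε = -1) ∧
        IsOfFinAddOrder (Affine.Point.map (W' := (C₂ • (D • E').quadraticTwist (d₁ : ℚ))) (c : K →ₐ[ℚ] K) P - ε • P) ∧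
        (∀ m, ∀ a ∈ A m, hτ.pointsMap (C₂ • (D • E').quadraticTwist (d₁ : ℚ)) a ∈ A m) ∧
        Pt 1 = toGeomPoints ((C₂ • (D • E').quadraticTwist (d₁ : ℚ)).baseChange K) P ∧
        (∀ m, m ≠ 0 → ∀ a ∈ A m, ∀ Φ : Field.absoluteGaloisGroup K,
          (∀ x : ringClassField K ι m, Φ • emb m x = emb m x) → Φ • a = a) ∧
        (∀ m : ℕ, Squarefree m →
          (∀ q ∈ m.primeFactors, IsKolyvaginPrime ((C₂ • (D • E').quadraticTwist (d₁ : ℚ)).conductorNorm ℤ) (C₂ • (D • E').quadraticTwist (d₁ : ℚ)) K p q ∧ FrobEqFrobInfty (C₂ • (D • E').quadraticTwist (d₁ : ℚ)) K (p ^ M) q) →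
          (∃ B ∈ A m, hτ.pointsMap (C₂ • (D • E').quadraticTwist (d₁ : ℚ)) (Pt m) =
            (ε * (-1) ^ m.primeFactors.card) • Pt m + ((p ^ M : ℕ) : ℤ) • B) ∧
          (∀ ℓ : ℕ, ℓ.Prime → ℓ ∣ m → ∀ v : HeightOneSpectrum (𝓞 K), (ℓ : 𝓞 K) ∈ v.asIdeal →
            ∀ a : ℕ, (((p : ℤ) ^ a) •
                kolyvaginClass ((C₂ • (D • E').quadraticTwist (d₁ : ℚ)).baseChange K) _ hdiv (hA m) (Pt m) (hPt m) ∈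
                selmerLocalKer ((C₂ • (D • E').quadraticTwist (d₁ : ℚ)).baseChange K) (v.adicCompletion K) ((p ^ M : ℕ) : ℤ) ↔
              ((p : ℤ) ^ a) • kolyvaginClass ((C₂ • (D • E').quadraticTwist (d₁ : ℚ)).baseChange K) _ hdiv (hA (m / ℓ)) (Pt (m / ℓ))
                  (hPt (m / ℓ)) ∈
                ((C₂ • (D • E').quadraticTwist (d₁ : ℚ)).baseChange K).torsionLocalKer (v.adicCompletion K) ((p ^ M : ℕ) : ℤ)))) := by
  -- §0 basic data
  have hp : p.Prime := Fact.out
  have hp2 : p ≠ 2 := by omega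
  haveI : NeZero ((C₂ • (D • E').quadraticTwist (d₁ : ℚ)).conductorNorm ℤ) :=
    ⟨(WeierstrassCurve.conductorNorm_pos_holds _).ne'⟩
  obtain ⟨DtW⟩ := hmodP (C₂ • (D • E').quadraticTwist (d₁ : ℚ))
  have hd10 : d₁ ≠ 0 := by
    rintro rfl
    apply hθ0
    have : θ ^ 2 = 0 := by rw [hθ2]; simp
    exact pow_eq_zero_iff (n := 2) (by norm_num) |>.mp this
  -- §1 the `E′` points over `x(m)` (named fact G1) — `0` off the coprime levels
  have hex : ∀ m : ℕ, m ≠ 0 → m.Coprime (E'.conductorNorm ℤ) →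
      ∃ Q : (E'.baseChange (ringClassField K ι m)).toAffine.Point,
        Affine.Point.map (ringClassField K ι m).subtype.toRatAlgHom Q =
          heegnerPointComplexOfConductor Dt (NumberField.discr K) β m :=
    fun m hm hmN => hG1 (E'.conductorNorm ℤ) E' K hK Dt β ι m hβ hm hmN
  obtain ⟨yE, hyEdef⟩ : ∃ yE : (m : ℕ) → (E'.baseChange (ringClassField K ι m)).toAffine.Point, ∀ m,
      yE m = if h : m ≠ 0 ∧ m.Coprime (E'.conductorNorm ℤ) then (hex m h.1 h.2).choose else 0 :=
    ⟨fun m => if h : m ≠ 0 ∧ m.Coprime (E'.conductorNorm ℤ) then (hex m h.1 h.2).choose else 0, fun _ => rfl⟩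
  have hyE : ∀ m (hm : m ≠ 0) (hmN : m.Coprime (E'.conductorNorm ℤ)),
      Affine.Point.map (ringClassField K ι m).subtype.toRatAlgHom (yE m) =
        heegnerPointComplexOfConductor Dt (NumberField.discr K) β m := by
    intro m hm hmN
    rw [hyEdef m, dif_pos (And.intro hm hmN)]
    exact (hex m hm hmN).choose_spec
  have hyE0 : ∀ m, ¬ (m ≠ 0 ∧ m.Coprime (E'.conductorNorm ℤ)) → yE m = 0 := fun m h => by
    rw [hyEdef m, dif_neg h]
  -- §2 the pin of Prop. 5.3 and the sign `ε`
  obtain ⟨σ₁, hσ₁, H53⟩ := hP53 (E'.conductorNorm ℤ) E' K hK Dt β ι hβ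
  set u₁ : ℤ := (s ⟨σ₁, hσ₁⟩ : ℤ) with hu₁def
  have hu₁ : u₁ = 1 ∨ u₁ = -1 := by
    rcases Int.units_eq_one_or (s ⟨σ₁, hσ₁⟩) with h | h
    · left; rw [hu₁def, h]; rfl
    · right; rw [hu₁def, h]; rfl
  have hσ₁θ : σ₁ θ = ((u₁ : ℤ) : ringClassField K ι 1) * θ := hθσ ⟨σ₁, hσ₁⟩
  set uτ : ℤ := Int.sign d₁ with huτdef
  have huτ : uτ = 1 ∨ uτ = -1 := by
    rcases lt_or_gt_of_ne hd10 with h | h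
    · right; exact Int.sign_eq_neg_one_of_neg h
    · left; exact Int.sign_eq_one_of_pos h
  set ε : ℤ := -E'.rootNumber * uτ * u₁ with hεdef
  have hε : ε = 1 ∨ ε = -1 := by
    rcases WeierstrassCurve.rootNumber_eq_one_or E' with h1 | h1 <;> rcases huτ with h2 | h2 <;>
      rcases hu₁ with h3 | h3 <;> simp [hεdef, h1, h2, h3]
  -- §3 the roots `ϑ_m = χ(m)·θ↑`
  have h1m : ∀ m : ℕ, m ≠ 0 → ringClassField K ι 1 ≤ ringClassField K ι m :=
    fun m hm => ringClassField_mono hK ι (one_dvd m) hm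
  obtain ⟨χ, hχdef⟩ : ∃ χ : ℕ → ℤ, ∀ m, χ m = if jacobiSym d₁ m = -1 then -1 else 1 := ⟨_, fun _ => rfl⟩
  have hχ : ∀ m, χ m = 1 ∨ χ m = -1 := fun m => by rw [hχdef]; exact levelSign_eq_one_or d₁ m
  obtain ⟨ϑ, hϑdef⟩ : ∃ ϑ : (m : ℕ) → m ≠ 0 → ringClassField K ι m, ∀ m (hm : m ≠ 0),
      ϑ m hm = ((χ m : ℤ) : ringClassField K ι m) * RingClassField.inclusion ι (h1m m hm) θ :=
    ⟨fun m hm => ((χ m : ℤ) : ringClassField K ι m) * RingClassField.inclusion ι (h1m m hm) θ, fun _ _ => rfl⟩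
  have hϑ2 : ∀ m (hm : m ≠ 0), ϑ m hm ^ 2 = algebraMap ℚ (ringClassField K ι m) (d₁ : ℚ) :=
    fun m hm => root_sq_eq ι (h1m m hm) (hχ m) hθ2 (hϑdef m hm)
  have hϑ0 : ∀ m (hm : m ≠ 0), ϑ m hm ≠ 0 := fun m hm => root_ne_zero ι (h1m m hm) (hχ m) hθ0 (hϑdef m hm)
  have hϑC : ∀ m (hm : m ≠ 0), (ϑ m hm : ℂ) = ((χ m : ℤ) : ℂ) * (θ : ℂ) :=
    fun m hm => coe_root ι (h1m m hm) (hϑdef m hm)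
  -- §4 the bare family
  obtain ⟨Y, hYdef⟩ : ∃ Y : (m : ℕ) → ((C₂ • (D • E').quadraticTwist (d₁ : ℚ)).baseChange (ringClassField K ι m)).toAffine.Point,
      ∀ m, Y m = if hm : m ≠ 0 then (VariableChange.pointEquivBaseChange ((D • E').quadraticTwist (d₁ : ℚ)) C₂ (ringClassField K ι m)
          ((VariableChange.pointEquiv (((D • E').quadraticTwist (d₁ : ℚ)).baseChange (ringClassField K ι m)) (untwistAt (hϑ0 m hm))).symm
            ((Affine.Point.congrEquiv (untwistAt_smul_eq (D • E') (hϑ2 m hm) (hϑ0 m hm))).symm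
              (VariableChange.pointEquivBaseChange E' D (ringClassField K ι m) (yE m))))) else 0 :=
    ⟨fun m => if hm : m ≠ 0 then (VariableChange.pointEquivBaseChange ((D • E').quadraticTwist (d₁ : ℚ)) C₂ (ringClassField K ι m)
          ((VariableChange.pointEquiv (((D • E').quadraticTwist (d₁ : ℚ)).baseChange (ringClassField K ι m)) (untwistAt (hϑ0 m hm))).symm
            ((Affine.Point.congrEquiv (untwistAt_smul_eq (D • E') (hϑ2 m hm) (hϑ0 m hm))).symm
              (VariableChange.pointEquivBaseChange E' D (ringClassField K ι m) (yE m))))) else 0, fun _ => rfl⟩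
  have hY : ∀ m (hm : m ≠ 0), Y m = (VariableChange.pointEquivBaseChange ((D • E').quadraticTwist (d₁ : ℚ)) C₂ (ringClassField K ι m)
          ((VariableChange.pointEquiv (((D • E').quadraticTwist (d₁ : ℚ)).baseChange (ringClassField K ι m)) (untwistAt (hϑ0 m hm))).symm
            ((Affine.Point.congrEquiv (untwistAt_smul_eq (D • E') (hϑ2 m hm) (hϑ0 m hm))).symm
              (VariableChange.pointEquivBaseChange E' D (ringClassField K ι m) (yE m))))) := fun m hm => by
    rw [hYdef m, dif_pos hm]
  -- §5 Kolyvagin-level bookkeeping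
  have hlev : ∀ {m : ℕ}, Squarefree m → (∀ q ∈ m.primeFactors, IsKolyvaginPrime ((C₂ • (D • E').quadraticTwist (d₁ : ℚ)).conductorNorm ℤ) (C₂ • (D • E').quadraticTwist (d₁ : ℚ)) K p q) →
      m.Coprime (E'.conductorNorm ℤ) ∧ d₁.gcd m = 1 ∧
      ∀ ℓ ∈ m.primeFactors, ℓ ≠ 2 ∧ (Ideal.span {(ℓ : 𝓞 K)}).IsPrime ∧ ¬ (ℓ : ℤ) ∣ d₁ ∧
        ¬ ℓ ∣ (C₂ • (D • E').quadraticTwist (d₁ : ℚ)).conductorNorm ℤ := by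
    intro m hm hKol
    have hm0 : m ≠ 0 := hm.ne_zero
    have hfacts : ∀ ℓ ∈ m.primeFactors, ℓ ≠ 2 ∧ (Ideal.span {(ℓ : 𝓞 K)}).IsPrime ∧ ¬ (ℓ : ℤ) ∣ d₁ ∧
        ¬ ℓ ∣ (C₂ • (D • E').quadraticTwist (d₁ : ℚ)).conductorNorm ℤ := by
      intro ℓ hℓ
      have hK' := hKol ℓ hℓ
      exact ⟨kolyvaginPrime_ne_two (C₂ • (D • E').quadraticTwist (d₁ : ℚ)) hp5 hp hK', hK'.2.2.2.2.1, fun h => hK'.2.2.1 (h.trans hd₁), hK'.2.1⟩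
    refine ⟨?_, ?_, hfacts⟩
    · refine (ModularAuxNorm.coprime_of_forall_primeFactors_not_dvd hm0 fun r hr hrN => ?_).symm
      obtain ⟨hr2, -, hrd, hrW⟩ := hfacts r hr
      haveI : Fact r.Prime := ⟨Nat.prime_of_mem_primeFactors hr⟩
      have hgoodW : (C₂ • (D • E').quadraticTwist (d₁ : ℚ)).HasGoodReductionAtPrime r :=
        not_not.mp (mt ((C₂ • (D • E').quadraticTwist (d₁ : ℚ)).dvd_conductorNorm_iff_not_hasGoodReductionAtPrime r).mpr hrW)
      have hgoodE := hasGoodReductionAtPrime_of_twist_presentation (C₂ • (D • E').quadraticTwist (d₁ : ℚ)) E' hE' hr2 hrd hgoodW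
      exact (E'.dvd_conductorNorm_iff_not_hasGoodReductionAtPrime r).mp hrN hgoodE
    · have hc : Nat.Coprime d₁.natAbs m :=
        ModularAuxNorm.coprime_of_forall_primeFactors_not_dvd (N := d₁.natAbs) hm0 fun r hr hrd =>
          (hfacts r hr).2.2.1 (Int.ofNat_dvd_left.mpr hrd)
      exact hc
  -- §6 label (B3) at every level `m ≠ 0`
  have hB3all : ∀ (m : ℕ), m ≠ 0 → ∀ τm : ringClassField K ι m ≃ₐ[ℚ] ringClassField K ι m,
      (∀ x : ringClassField K ι m, ((τm x : ringClassField K ι m) : ℂ) = conj (x : ℂ)) →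
      ∃ σ' ∈ ringClassGal ι m, IsOfFinAddOrder
        (pointGalHom (C₂ • (D • E').quadraticTwist (d₁ : ℚ)) (ringClassField K ι m) τm (Y m) - ε • pointGalHom (C₂ • (D • E').quadraticTwist (d₁ : ℚ)) (ringClassField K ι m) σ' (Y m)) := by
    intro m hm0 τm hτm
    by_cases hgood : m ≠ 0 ∧ m.Coprime (E'.conductorNorm ℤ)
    · obtain ⟨σ', hσ', hpin, hfin⟩ := H53 m hm0 hgood.2 (yE m) (hyE m hm0 hgood.2) τm hτm
      refine ⟨σ', hσ', ?_⟩
      rw [hY m hm0]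
      exact label_B3_level ι E' D C₂ d₁ (hϑ2 m hm0) (hϑ0 m hm0) huτ hu₁
        (apply_root_eq_of_conj ι hθ2 hθ0 (hϑC m hm0) τm hτm)
        (apply_root_eq_of_pinned ι (hϑC m hm0) hpin hσ₁θ) hfin
    · refine ⟨1, one_mem _, ?_⟩
      rw [hY m hm0, hyE0 m hgood]
      simp only [map_zero, smul_zero, sub_zero]
      exact IsOfFinAddOrder.zero
  -- §7 label (B2)
  have hyE1 : yE 1 = y := by
    apply Affine.Point.map_injective (f := (ringClassField K ι 1).subtype.toRatAlgHom)
    rw [hyE 1 one_ne_zero (Nat.coprime_one_left (E'.conductorNorm ℤ)), hy]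
  have hϑ1 : ϑ 1 one_ne_zero = θ := by
    apply Subtype.ext
    rw [hϑC 1 one_ne_zero]
    have : χ 1 = 1 := by rw [hχdef]; simp [jacobiSym.one_right]
    rw [this]; push_cast; ring
  have hB2 : ∀ T : Finset (ringClassField K ι 1 ≃ₐ[ℚ] ringClassField K ι 1),
      (∀ g, g ∈ T ↔ g ∈ ringClassGal ι 1) →
      Affine.Point.map (algebraMap K (ringClassField K ι 1)).toRatAlgHom P =
        ∑ g ∈ T, pointGalHom (C₂ • (D • E').quadraticTwist (d₁ : ℚ)) (ringClassField K ι 1) g (Y 1) := by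
    intro T hT
    rw [hY 1 one_ne_zero, hyE1, twist_congr E' D C₂ d₁ (hϑ2 1 one_ne_zero) (hϑ0 1 one_ne_zero) hθ2 hθ0 hϑ1,
      hP, Finset.sum_subtype T hT (fun g => pointGalHom (C₂ • (D • E').quadraticTwist (d₁ : ℚ)) (ringClassField K ι 1) g (VariableChange.pointEquivBaseChange ((D • E').quadraticTwist (d₁ : ℚ)) C₂ (ringClassField K ι 1)
          ((VariableChange.pointEquiv (((D • E').quadraticTwist (d₁ : ℚ)).baseChange (ringClassField K ι 1)) (untwistAt hθ0)).symm
            ((Affine.Point.congrEquiv (untwistAt_smul_eq (D • E') hθ2 hθ0)).symm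
              (VariableChange.pointEquivBaseChange E' D (ringClassField K ι 1) y)))))]
    have key := twist_sum_smul_pointGalHom' E' D C₂ (d₁ : ℚ) hθ2 hθ0 (Finset.univ : Finset (ringClassGal ι 1))
      (fun τ => τ.1) (fun τ => (s τ : ℤ)) (fun τ _ => by
        rcases Int.units_eq_one_or (s τ) with h | h
        · left; rw [h]; rfl
        · right; rw [h]; rfl) (fun τ _ => hθσ τ) y
    exact key
  -- §8 label (B3₀)
  have hB3K := ShimuraKolyvaginConjKLevel.isOfFinAddOrder_map_sub_smul_of_labels hK ι Y hB2 hB3all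
  -- §9 labels (B4), (B5), (B3) in K4e′'s guarded shape, and the assembly
  have key := hpointsRk_of_shimuraLabels_kolyvaginGuarded hK ι (W := (C₂ • (D • E').quadraticTwist (d₁ : ℚ))) rfl DtW hp hp2 hsurj Y hε hB2
    (fun m hm hKol τm hτm => hB3all m hm.ne_zero τm hτm) hB3K ?_ ?_
  · intro M hM hdiv c hc
    obtain ⟨ε₀, τ, hτ, A, hA, emb, Pt, hPt, hε₀, h53, hAτ, hPt1, hrat, -, hsq⟩ := key 0 hM hdiv c hc
    exact ⟨ε₀, τ, hτ, A, hA, emb, Pt, hPt, hε₀, h53, hAτ, hPt1, hrat,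
      fun m hm hk => ⟨(hsq m hm hk).2.1, (hsq m hm hk).2.2⟩⟩
  · -- (B4)
    intro m hm hKol ℓ hℓm hle σ hσ
    obtain ⟨hmN, hgcd, hfacts⟩ := hlev hm hKol
    obtain ⟨hℓ2, hinert, hℓd, hℓW⟩ := hfacts ℓ hℓm
    have hℓ : ℓ.Prime := Nat.prime_of_mem_primeFactors hℓm
    haveI : Fact ℓ.Prime := ⟨hℓ⟩
    have hm0 : m ≠ 0 := hm.ne_zero
    have hℓdvd : ℓ ∣ m := Nat.dvd_of_mem_primeFactors hℓm
    have hm'0 : m / ℓ ≠ 0 := fun h => hm0 (by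
      rw [← Nat.mul_div_cancel' hℓdvd, h, mul_zero])
    have hm'N : (m / ℓ).Coprime (E'.conductorNorm ℤ) := Nat.Coprime.coprime_dvd_left (Nat.div_dvd_of_dvd hℓdvd) hmN
    have hgoodW : (C₂ • (D • E').quadraticTwist (d₁ : ℚ)).HasGoodReductionAtPrime ℓ :=
      not_not.mp (mt ((C₂ • (D • E').quadraticTwist (d₁ : ℚ)).dvd_conductorNorm_iff_not_hasGoodReductionAtPrime ℓ).mpr hℓW)
    have hgoodE := hasGoodReductionAtPrime_of_twist_presentation (C₂ • (D • E').quadraticTwist (d₁ : ℚ)) E' hE' hℓ2 hℓd hgoodW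
    have hϑϑ' : (ϑ m hm0 : ℂ) = (legendreSym ℓ d₁ : ℂ) * (ϑ (m / ℓ) hm'0 : ℂ) := by
      rw [hϑC m hm0, hϑC (m / ℓ) hm'0, ← mul_assoc]
      congr 1
      rw [hχdef m, hχdef (m / ℓ)]
      exact_mod_cast levelSign_eq_legendreSym_mul hℓdvd hm0 hgcd
    rw [hY m hm0, hY (m / ℓ) hm'0]
    exact label_B4_level hK ι hD4 E' D C₂ d₁ Dt hβ hm hℓm hℓ2 hinert hℓd hgoodW hgoodE hmN hle σ hσ
      (hϑ2 m hm0) (hϑ0 m hm0) (hϑ2 (m / ℓ) hm'0) (hϑ0 (m / ℓ) hm'0) hϑϑ' (hyE m hm0 hmN)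
      (hyE (m / ℓ) hm'0 hm'N)
  · -- (B5)
    intro m hm hKol ℓ hℓm _ hΔ φ₀ hφ₀ hle emb hemb j hj γ _
    obtain ⟨hmN, hgcd, hfacts⟩ := hlev hm hKol
    obtain ⟨hℓ2, hinert, hℓd, hℓW⟩ := hfacts ℓ hℓm
    have hℓ : ℓ.Prime := Nat.prime_of_mem_primeFactors hℓm
    have hm0 : m ≠ 0 := hm.ne_zero
    have hℓdvd : ℓ ∣ m := Nat.dvd_of_mem_primeFactors hℓm
    have hm'0 : m / ℓ ≠ 0 := fun h => hm0 (by
      rw [← Nat.mul_div_cancel' hℓdvd, h, mul_zero])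
    have hm'N : (m / ℓ).Coprime (E'.conductorNorm ℤ) := Nat.Coprime.coprime_dvd_left (Nat.div_dvd_of_dvd hℓdvd) hmN
    have hgoodW : (C₂ • (D • E').quadraticTwist (d₁ : ℚ)).HasGoodReductionAtPrime ℓ :=
      not_not.mp (mt ((C₂ • (D • E').quadraticTwist (d₁ : ℚ)).dvd_conductorNorm_iff_not_hasGoodReductionAtPrime ℓ).mpr hℓW)
    have hgoodE := hasGoodReductionAtPrime_of_twist_presentation (C₂ • (D • E').quadraticTwist (d₁ : ℚ)) E' hE' hℓ2 hℓd hgoodW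
    have hϑϑ' : (ϑ m hm0 : ℂ) = (legendreSym ℓ d₁ : ℂ) * (ϑ (m / ℓ) hm'0 : ℂ) := by
      rw [hϑC m hm0, hϑC (m / ℓ) hm'0, ← mul_assoc]
      congr 1
      rw [hχdef m, hχdef (m / ℓ)]
      exact_mod_cast levelSign_eq_legendreSym_mul hℓdvd hm0 hgcd
    rw [hY m hm0, hY (m / ℓ) hm'0]
    exact label_B5_level hNek hK ι E' D C₂ d₁ Dt hβ hm hℓm hℓ2 hinert hℓd hgoodE hmN hΔ hle
      (hϑ2 m hm0) (hϑ0 m hm0) (hϑ2 (m / ℓ) hm'0) (hϑ0 (m / ℓ) hm'0) hϑϑ' (hyE m hm0 hmN)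
      (hyE (m / ℓ) hm'0 hm'N) hφ₀ emb j hj γ

end Summit.BirchSwinnertonDyer.BirchSwinnertonDyer.Theorems.GenusKolyvagin

end
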